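import Mathlib.LinearAlgebra.BilinearForm.Orthogonal
import HarnessLib

/-!
# Real-signature duality for Selmer structures: `S(U)^⊥ = S(U^⊥)`, Lagrangian and complementarity laws
# (route `AlignedTransportAtTwo`, crux C2 `MainConjectureOfRankZeroBSDAtTwo`, line `birth`, road (b″) at `Δ_E > 0`)

HONEST FRAMING (cell `bsd-f1-sign2`; WIDTH-5 attached prover seat `bsd-line-att-p5` gen 3; `--supports`
stmt-BirchSwinnertonDyer-22298; closes nothing; BSD is proved for no curve here).  THEOREMS ONLY, pure linear
algebra over a field (Mathlib `LinearMap.BilinForm`).  This is the KERNEL form of the lead prover's «CONSISTENCY CHECK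
(pure duality, kernel-provable as linear algebra)» of the crux workfile `ARCH-NETTING.md` (att-p2 g3, 2026-08-28):
where the archimedean `(Λ/2)^{[Δ_E>0]}` of Greenberg (LNM 1716, Lemma 4.6 at `p = 2`) and the «one bit» `b(E)` of
`ARCH-BALANCE-v2.md` (att-p4 g2) sit at a finite layer.

THE MODEL.  At layer `n` of the cyclotomic `ℤ₂`-tower, with `M = E[2^k]`: `V = ⊕_{v ∈ Σ} H¹(ℚ_{n,v}, M)` with the
(non-degenerate, reflexive) sum of local Tate pairings `B`; `I ≤ V` the image of `H¹(G_Σ(ℚ_n), M)`, which is its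
own orthogonal (`I^⊥ = I`, Poitou–Tate); `V = V₁ ⊕ V∞` the orthogonal splitting into the finite places `V₁` and the
real places `V∞ = ⊕_{v real} H¹(ℝ, M)` (`≅ (ℤ/2)^{2·2ⁿ}` when `E[2] ⊂ E(ℝ)`, `= 0` when `Δ_E < 0`); a SELMER
STRUCTURE at the finite places is a subspace `U ≤ V₁` (e.g. `U = W ⊕ L_bad` with `W` the condition at `2`: ordinary
`W = W^⊥`, fine `W = 0`, relaxed `W = H¹(ℚ_{n,2}, M)`).  The REAL-SIGNATURE SPACE of `U` is
`S(U) := π∞(I ∩ (U ⊕ V∞)) = (I + U) ∩ V∞` — the real components realised by global classes satisfying `U` at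
the finite places and NO condition at `∞` (`realSignature_eq`: the two descriptions agree).  The relaxed-at-`∞`
Selmer group of `U` modulo the strict one IS `S(U)`; Greenberg's Lemma 4.6 says `S(Sel) ` is as large as possible
compatibly with duality, i.e. LAGRANGIAN.

THE LAWS (hypotheses: `B` non-degenerate and reflexive, `V` finite-dimensional, `IsCompl V₁ V∞`, `V₁^⊥ = V∞`,
`I^⊥ = I`, `U ≤ V₁`):
* `realSignature_orthogonal` — **`S(U)^⊥ ∩ V∞ = S(U^⊥ ∩ V₁)`**: the real signatures of the dual Selmer structure
  are the orthogonal complement, inside `V∞`, of the real signatures of `U`;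
* `finrank_realSignature_add` — **`dim S(U) + dim S(U^⊥ ∩ V₁) = dim V∞`** (COMPLEMENTARITY): in particular
  `dim S(0) + dim S(V₁) = dim V∞` (`finrank_realSignature_bot_add_top`): the FINE side (`U = 0` at all finite
  places) realises few real components iff the side relaxed at all finite places realises almost all — this is
  where `b(E) ∈ {0,1}` lives;
* `realSignature_orthogonal_self`, `two_mul_finrank_realSignature` — if `U^⊥ ∩ V₁ = U` (self-dual structure, e.g.
  ordinary at `2` ⊕ unramified elsewhere) then `S(U)` is LAGRANGIAN in `V∞`: `S(U)^⊥ ∩ V∞ = S(U)` and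
  `2·dim S(U) = dim V∞` — the finite-level shadow of `X^{rel∞}/X^{str} ≅ (Λ/2)^{[Δ_E>0]}` (`dim = 2ⁿ` out of
  `2·2ⁿ`).
Supporting lattice lemmas: `orthogonal_sup'` (`(A ⊔ C)^⊥ = A^⊥ ⊓ C^⊥`, always), `orthogonal_inf'`
(`(A ⊓ C)^⊥ = A^⊥ ⊔ C^⊥`, non-degenerate finite-dimensional), `finrank_orthogonal_inf_add` (`dim(S^⊥ ∩ V∞) + dim S
= dim V∞` for `S ≤ V∞`).

NOT HERE: no Galois cohomology, no Poitou–Tate (the isotropy `I^⊥ = I` and the orthogonal splitting are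
HYPOTHESES), no Selmer group of the tree is mentioned; the arithmetic reading above is the docstrings' only link to
the crux.  References: Greenberg, LNM 1716 (1999) §4 Lemma 4.6 and pp. 98–99 (archimedean factor at `p = 2`);
Milne, *Arithmetic Duality Theorems* I.4.10 (Poitou–Tate); the cell's `ARCH-NETTING.md`, `ARCH-BALANCE-v2.md`.
-/

set_option linter.dupNamespace false
set_option autoImplicit false

namespace Summit.BirchSwinnertonDyer.BirchSwinnertonDyer.Theorems.AlignedTransportAtTwoRealSignature

open Module

variable {K : Type*} {V : Type*} [Field K] [AddCommGroup V] [Module K V]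

/-! ## §1 Lattice lemmas for the orthogonal complement of a bilinear form -/

section Lattice

variable (B : LinearMap.BilinForm K V)

/-- `(A ⊔ C)^⊥ = A^⊥ ⊓ C^⊥` for the (right) orthogonal complement of any bilinear form — no hypothesis. [folklore] -/
theorem orthogonal_sup' (A C : Submodule K V) :
    B.orthogonal (A ⊔ C) = B.orthogonal A ⊓ B.orthogonal C := by
  apply le_antisymm
  · exact le_inf (B.orthogonal_le le_sup_left) (B.orthogonal_le le_sup_right)
  · intro x hx
    rw [Submodule.mem_inf, LinearMap.BilinForm.mem_orthogonal_iff,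
      LinearMap.BilinForm.mem_orthogonal_iff] at hx
    rw [LinearMap.BilinForm.mem_orthogonal_iff]
    intro n hn
    obtain ⟨a, ha, c, hc, rfl⟩ := Submodule.mem_sup.mp hn
    rw [map_add, LinearMap.add_apply, hx.1 a ha, hx.2 c hc, add_zero]

variable {B} [FiniteDimensional K V]

/-- `(A ⊓ C)^⊥ = A^⊥ ⊔ C^⊥` for a NON-DEGENERATE reflexive form on a finite-dimensional space (from `orthogonal_sup'`
and `W^⊥⊥ = W`). [folklore] -/
theorem orthogonal_inf' (hB : B.Nondegenerate) (hR : B.IsRefl) (A C : Submodule K V) :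
    B.orthogonal (A ⊓ C) = B.orthogonal A ⊔ B.orthogonal C := by
  have h := orthogonal_sup' B (B.orthogonal A) (B.orthogonal C)
  rw [LinearMap.BilinForm.orthogonal_orthogonal hB hR, LinearMap.BilinForm.orthogonal_orthogonal hB hR] at h
  rw [← h, LinearMap.BilinForm.orthogonal_orthogonal hB hR]

/-- For an orthogonal splitting `V₁^⊥ = V∞` of a non-degenerate reflexive form, also `V∞^⊥ = V₁`. [folklore] -/
theorem orthogonal_eq_of_orthogonal_eq (hB : B.Nondegenerate) (hR : B.IsRefl) {V₁ Vinf : Submodule K V}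
    (h₁ : B.orthogonal V₁ = Vinf) : B.orthogonal Vinf = V₁ := by
  rw [← h₁, LinearMap.BilinForm.orthogonal_orthogonal hB hR]

omit [FiniteDimensional K V] in
/-- For `S ≤ V∞` with `V = V₁ ⊕ V∞` orthogonal: `S^⊥ = V₁ ⊔ (S^⊥ ∩ V∞)` — the orthogonal of a real-signature space
contains all the finite places. [folklore] -/
theorem orthogonal_eq_sup_of_le (hR : B.IsRefl) {V₁ Vinf : Submodule K V} (hc : IsCompl V₁ Vinf)
    (h₁ : B.orthogonal V₁ = Vinf) {S : Submodule K V} (hS : S ≤ Vinf) :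
    B.orthogonal S = V₁ ⊔ B.orthogonal S ⊓ Vinf := by
  have hV₁ : V₁ ≤ B.orthogonal S := by
    calc V₁ ≤ B.orthogonal (B.orthogonal V₁) := LinearMap.BilinForm.le_orthogonal_orthogonal hR
      _ ≤ B.orthogonal S := B.orthogonal_le (h₁ ▸ hS)
  calc B.orthogonal S = B.orthogonal S ⊓ (V₁ ⊔ Vinf) := by rw [hc.sup_eq_top, inf_top_eq]
    _ = V₁ ⊔ B.orthogonal S ⊓ Vinf := by
      rw [inf_comm, sup_inf_assoc_of_le Vinf hV₁, inf_comm]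

/-- **Dimension law inside `V∞`**: for `S ≤ V∞`, `dim(S^⊥ ∩ V∞) + dim S = dim V∞` (non-degenerate reflexive `B`,
orthogonal splitting `V = V₁ ⊕ V∞`). [folklore] -/
theorem finrank_orthogonal_inf_add (hB : B.Nondegenerate) (hR : B.IsRefl) {V₁ Vinf : Submodule K V}
    (hc : IsCompl V₁ Vinf) (h₁ : B.orthogonal V₁ = Vinf) {S : Submodule K V} (hS : S ≤ Vinf) :
    finrank K ↥(B.orthogonal S ⊓ Vinf) + finrank K S = finrank K Vinf := by
  have hsplit := orthogonal_eq_sup_of_le hR hc h₁ hS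
  -- `dim S^⊥ = dim V₁ + dim (S^⊥ ∩ V∞)` (the sup is disjoint)
  have hdisj : Disjoint V₁ (B.orthogonal S ⊓ Vinf) := hc.disjoint.mono_right inf_le_right
  have hdim : finrank K ↥(B.orthogonal S) = finrank K V₁ + finrank K ↥(B.orthogonal S ⊓ Vinf) := by
    have h2 := Submodule.finrank_sup_add_finrank_inf_eq V₁ (B.orthogonal S ⊓ Vinf)
    rw [hdisj.eq_bot, ← hsplit] at h2
    simpa using h2
  have hperp := LinearMap.BilinForm.finrank_orthogonal hB S
  have hV : finrank K V₁ + finrank K Vinf = finrank K V := by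
    have h3 := Submodule.finrank_sup_add_finrank_inf_eq V₁ Vinf
    rw [hc.sup_eq_top, hc.inf_eq_bot] at h3
    simpa using h3.symm
  have hSle : finrank K S ≤ finrank K Vinf := Submodule.finrank_mono hS
  omega

end Lattice

/-! ## §2 The real-signature space of a Selmer structure and its duality -/

section RealSignature

variable [FiniteDimensional K V] {B : LinearMap.BilinForm K V}

omit [FiniteDimensional K V] in
/-- **The two descriptions of the real-signature space agree**: for `U ≤ V₁` and `V₁ ∩ V∞ = 0`,
`π∞(I ∩ (U ⊕ V∞)) = (I + U) ∩ V∞` — in lattice form `((I ⊓ (U ⊔ V∞)) ⊔ V₁) ⊓ V∞ = (I ⊔ U) ⊓ V∞`.  (A real vector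
`y` is the `∞`-component of a global class satisfying `U` at the finite places iff `y + u` is global for some
`u ∈ U`.) [folklore] -/
theorem realSignature_eq {V₁ Vinf : Submodule K V} (hd : Disjoint V₁ Vinf) (I : Submodule K V)
    {U : Submodule K V} (hU : U ≤ V₁) :
    ((I ⊓ (U ⊔ Vinf)) ⊔ V₁) ⊓ Vinf = (I ⊔ U) ⊓ Vinf := by
  apply le_antisymm
  · rintro y ⟨hy, hyinf⟩
    obtain ⟨j, ⟨hjI, hjUV⟩, v₁, hv₁, rfl⟩ := Submodule.mem_sup.mp hy
    obtain ⟨u, hu, z, hz, rfl⟩ := Submodule.mem_sup.mp hjUV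
    -- `(u + z) + v₁ ∈ V∞` with `z ∈ V∞` forces `u + v₁ ∈ V₁ ∩ V∞ = 0`
    have huv : u + v₁ ∈ V₁ ⊓ Vinf := by
      refine ⟨V₁.add_mem (hU hu) hv₁, ?_⟩
      have h' : u + z + v₁ - z ∈ Vinf := Vinf.sub_mem hyinf hz
      have h'' : u + z + v₁ - z = u + v₁ := by abel
      exact h'' ▸ h'
    rw [hd.eq_bot, Submodule.mem_bot] at huv
    have hv₁' : v₁ = -u := eq_neg_of_add_eq_zero_right huv
    refine ⟨?_, hyinf⟩
    subst hv₁'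
    -- `u + z + (-u) = (u + z) + (-u)` with `u + z ∈ I`, `-u ∈ U`
    exact Submodule.mem_sup.mpr ⟨u + z, hjI, -u, U.neg_mem hu, rfl⟩
  · rintro y ⟨hy, hyinf⟩
    obtain ⟨i, hi, u, hu, rfl⟩ := Submodule.mem_sup.mp hy
    refine ⟨Submodule.mem_sup.mpr ⟨i, ⟨hi, ?_⟩, u, hU hu, rfl⟩, hyinf⟩
    -- `i = (-u) + (i + u)` with `-u ∈ U`, `i + u ∈ V∞`
    have : i = -u + (i + u) := by abel
    rw [this]
    exact Submodule.add_mem _ (Submodule.mem_sup_left (U.neg_mem hu)) (Submodule.mem_sup_right hyinf)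

/-- **Real-signature duality `S(U)^⊥ ∩ V∞ = S(U^⊥ ∩ V₁)`.**  For a non-degenerate reflexive form `B` on the
finite-dimensional `V = V₁ ⊕ V∞` (orthogonal: `V₁^⊥ = V∞`), a maximal isotropic `I` (`I^⊥ = I`, Poitou–Tate) and a
Selmer structure `U ≤ V₁` at the finite places, the orthogonal complement inside `V∞` of the real-signature space
`S(U) = (I + U) ∩ V∞` is the real-signature space of the DUAL structure `U^⊥ ∩ V₁`. [folklore] -/
theorem realSignature_orthogonal (hB : B.Nondegenerate) (hR : B.IsRefl) {V₁ Vinf : Submodule K V}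
    (hc : IsCompl V₁ Vinf) (h₁ : B.orthogonal V₁ = Vinf) {I : Submodule K V} (hI : B.orthogonal I = I)
    {U : Submodule K V} (hU : U ≤ V₁) :
    B.orthogonal ((I ⊔ U) ⊓ Vinf) ⊓ Vinf = (I ⊔ B.orthogonal U ⊓ V₁) ⊓ Vinf := by
  have hinf : B.orthogonal Vinf = V₁ := orthogonal_eq_of_orthogonal_eq hB hR h₁
  -- `((I ⊔ U) ⊓ V∞)^⊥ = (I ⊓ U^⊥) ⊔ V₁`
  rw [orthogonal_inf' hB hR, orthogonal_sup' B, hI, hinf]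
  -- the dual structure `U' = U^⊥ ⊓ V₁ ≤ V₁` has `U' ⊔ V∞ = U^⊥` (modular law; `V∞ = V₁^⊥ ≤ U^⊥`)
  have hVU : Vinf ≤ B.orthogonal U := h₁ ▸ B.orthogonal_le hU
  have hU' : B.orthogonal U ⊓ V₁ ⊔ Vinf = B.orthogonal U := by
    rw [inf_sup_assoc_of_le V₁ hVU, hc.sup_eq_top, inf_top_eq]
  -- `S(U') = ((I ⊓ (U' ⊔ V∞)) ⊔ V₁) ⊓ V∞ = (I ⊔ U') ⊓ V∞` by `realSignature_eq`
  have key := realSignature_eq hc.disjoint I (inf_le_right : B.orthogonal U ⊓ V₁ ≤ V₁)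
  rw [hU'] at key
  exact key

/-- **Complementarity law** `dim S(U) + dim S(U^⊥ ∩ V₁) = dim V∞`. [folklore] -/
theorem finrank_realSignature_add (hB : B.Nondegenerate) (hR : B.IsRefl) {V₁ Vinf : Submodule K V}
    (hc : IsCompl V₁ Vinf) (h₁ : B.orthogonal V₁ = Vinf) {I : Submodule K V} (hI : B.orthogonal I = I)
    {U : Submodule K V} (hU : U ≤ V₁) :
    finrank K ↥((I ⊔ U) ⊓ Vinf) + finrank K ↥((I ⊔ B.orthogonal U ⊓ V₁) ⊓ Vinf) = finrank K Vinf := by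
  rw [← realSignature_orthogonal hB hR hc h₁ hI hU, add_comm]
  exact finrank_orthogonal_inf_add hB hR hc h₁ inf_le_right

/-- **Fine versus relaxed** (`U = 0` versus `U = V₁`): `dim (I ∩ V∞) + dim ((I + V₁) ∩ V∞) = dim V∞` — the real
signatures of the classes trivial at all finite places and those of all global classes have complementary
dimensions. [folklore] -/
theorem finrank_realSignature_bot_add_top (hB : B.Nondegenerate) (hR : B.IsRefl) {V₁ Vinf : Submodule K V}
    (hc : IsCompl V₁ Vinf) (h₁ : B.orthogonal V₁ = Vinf) {I : Submodule K V} (hI : B.orthogonal I = I) :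
    finrank K ↥(I ⊓ Vinf) + finrank K ↥((I ⊔ V₁) ⊓ Vinf) = finrank K Vinf := by
  have h := finrank_realSignature_add hB hR hc h₁ hI (bot_le : (⊥ : Submodule K V) ≤ V₁)
  rw [sup_bot_eq, LinearMap.BilinForm.orthogonal_bot, top_inf_eq] at h
  exact h

/-- **Lagrangian law, orthogonality**: a SELF-DUAL structure (`U^⊥ ∩ V₁ = U`, e.g. ordinary at `2` with the
unramified conditions elsewhere) has a self-orthogonal real-signature space: `S(U)^⊥ ∩ V∞ = S(U)`. [folklore] -/
theorem realSignature_orthogonal_self (hB : B.Nondegenerate) (hR : B.IsRefl) {V₁ Vinf : Submodule K V}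
    (hc : IsCompl V₁ Vinf) (h₁ : B.orthogonal V₁ = Vinf) {I : Submodule K V} (hI : B.orthogonal I = I)
    {U : Submodule K V} (hU : U ≤ V₁) (hself : B.orthogonal U ⊓ V₁ = U) :
    B.orthogonal ((I ⊔ U) ⊓ Vinf) ⊓ Vinf = (I ⊔ U) ⊓ Vinf := by
  rw [realSignature_orthogonal hB hR hc h₁ hI hU, hself]

/-- **Lagrangian law, dimension**: for a self-dual structure `2·dim S(U) = dim V∞` — the Selmer side realises
exactly HALF of the real components (Greenberg's `(Λ/2)^{[Δ_E>0]}` at a finite layer: `2ⁿ` out of `2·2ⁿ`).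
[folklore] -/
theorem two_mul_finrank_realSignature (hB : B.Nondegenerate) (hR : B.IsRefl) {V₁ Vinf : Submodule K V}
    (hc : IsCompl V₁ Vinf) (h₁ : B.orthogonal V₁ = Vinf) {I : Submodule K V} (hI : B.orthogonal I = I)
    {U : Submodule K V} (hU : U ≤ V₁) (hself : B.orthogonal U ⊓ V₁ = U) :
    2 * finrank K ↥((I ⊔ U) ⊓ Vinf) = finrank K Vinf := by
  have h := finrank_realSignature_add hB hR hc h₁ hI hU
  rw [hself] at h
  omega

end RealSignature

/-! ## §3 Three blocks: the place `2`, the other finite places, the real places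

`V₁ = V₂ ⊕ V_b` orthogonally (`V_b ≤ V₂^⊥`, `IsCompl` inside `V₁`), a condition `W ≤ V₂` at `2` and a SELF-DUAL
condition `L ≤ V_b` at the other finite places (`L^⊥ ∩ V_b = L`: unramified classes), `U = W ⊔ L`.  Then the dual
structure is `U^⊥ ∩ V₁ = (W^⊥ ∩ V₂) ⊔ L` (`orthogonal_sup_inf_eq_of_blocks`): FINE (`W = 0`) is dual to RELAXED AT `2`
(`W = V₂`), and ORDINARY-type (`W^⊥ ∩ V₂ = W`) is self-dual. -/

section Blocks

variable [FiniteDimensional K V] {B : LinearMap.BilinForm K V}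

omit [FiniteDimensional K V] in
/-- Dual of a block structure: for `V₁ = V₂ ⊕ V_b` with `V_b ≤ V₂^⊥`, `W ≤ V₂`, `L ≤ V_b`:
`(W ⊔ L)^⊥ ∩ V₁ = (W^⊥ ∩ V₂) ⊔ (L^⊥ ∩ V_b)` (reflexive `B`). [folklore] -/
theorem orthogonal_sup_inf_eq_of_blocks (hR : B.IsRefl) {V₁ V₂ Vb W L : Submodule K V}
    (h2 : V₂ ≤ V₁) (hb : Vb ≤ V₁) (hsup : V₂ ⊔ Vb = V₁) (horth : Vb ≤ B.orthogonal V₂)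
    (hW : W ≤ V₂) (hL : L ≤ Vb) :
    B.orthogonal (W ⊔ L) ⊓ V₁ = (B.orthogonal W ⊓ V₂) ⊔ (B.orthogonal L ⊓ Vb) := by
  -- `V₂ ≤ V_b^⊥` from reflexivity
  have horth' : V₂ ≤ B.orthogonal Vb := by
    intro x hx
    rw [LinearMap.BilinForm.mem_orthogonal_iff]
    intro b hbb
    exact hR _ _ ((LinearMap.BilinForm.mem_orthogonal_iff.mp (horth hbb)) x hx)
  apply le_antisymm
  · intro x hx'
    obtain ⟨hx, hx₁⟩ := Submodule.mem_inf.mp hx'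
    rw [← hsup] at hx₁
    obtain ⟨x₂, hx₂, xb, hxb, rfl⟩ := Submodule.mem_sup.mp hx₁
    rw [orthogonal_sup' B] at hx
    obtain ⟨hxW, hxL⟩ := Submodule.mem_inf.mp hx
    refine Submodule.mem_sup.mpr ⟨x₂, Submodule.mem_inf.mpr ⟨?_, hx₂⟩, xb, Submodule.mem_inf.mpr ⟨?_, hxb⟩, rfl⟩
    · rw [LinearMap.BilinForm.mem_orthogonal_iff] at hxW ⊢
      intro w hw
      have h1 := hxW w hw
      have h2' : B w xb = 0 := (LinearMap.BilinForm.mem_orthogonal_iff.mp (horth hxb)) w (hW hw)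
      rw [map_add, h2', add_zero] at h1
      exact h1
    · rw [LinearMap.BilinForm.mem_orthogonal_iff] at hxL ⊢
      intro l hl
      have h1 := hxL l hl
      have h2' : B l x₂ = 0 := (LinearMap.BilinForm.mem_orthogonal_iff.mp (horth' hx₂)) l (hL hl)
      rw [map_add, h2', zero_add] at h1
      exact h1
  · apply sup_le
    · intro x hx'
      obtain ⟨hxW, hx₂⟩ := Submodule.mem_inf.mp hx'
      refine Submodule.mem_inf.mpr ⟨?_, h2 hx₂⟩
      rw [orthogonal_sup' B]
      refine Submodule.mem_inf.mpr ⟨hxW, ?_⟩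
      rw [LinearMap.BilinForm.mem_orthogonal_iff]
      intro l hl
      exact (LinearMap.BilinForm.mem_orthogonal_iff.mp (horth' hx₂)) l (hL hl)
    · intro x hx'
      obtain ⟨hxL, hxb⟩ := Submodule.mem_inf.mp hx'
      refine Submodule.mem_inf.mpr ⟨?_, hb hxb⟩
      rw [orthogonal_sup' B]
      refine Submodule.mem_inf.mpr ⟨?_, hxL⟩
      rw [LinearMap.BilinForm.mem_orthogonal_iff]
      intro w hw
      exact (LinearMap.BilinForm.mem_orthogonal_iff.mp (horth hxb)) w (hW hw)

omit [FiniteDimensional K V] in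
/-- With a self-dual condition `L^⊥ ∩ V_b = L` away from `2`, the dual of `U = W ⊔ L` is `(W^⊥ ∩ V₂) ⊔ L`. [folklore] -/
theorem orthogonal_sup_inf_eq_of_selfDual (hR : B.IsRefl) {V₁ V₂ Vb W L : Submodule K V}
    (h2 : V₂ ≤ V₁) (hb : Vb ≤ V₁) (hsup : V₂ ⊔ Vb = V₁) (horth : Vb ≤ B.orthogonal V₂)
    (hW : W ≤ V₂) (hL : L ≤ Vb) (hLself : B.orthogonal L ⊓ Vb = L) :
    B.orthogonal (W ⊔ L) ⊓ V₁ = (B.orthogonal W ⊓ V₂) ⊔ L := by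
  rw [orthogonal_sup_inf_eq_of_blocks hR h2 hb hsup horth hW hL, hLself]

/-- **Fine is dual to relaxed-at-`2`**: `S(0 ⊕ L)^⊥ ∩ V∞ = S(V₂ ⊕ L)` — the real signatures of the FINE classes
(trivial at `2`, unramified elsewhere, no condition at `∞`) and those of the classes with NO condition at `2` are
orthogonal complements inside `V∞`. [folklore] -/
theorem realSignature_fine_orthogonal (hB : B.Nondegenerate) (hR : B.IsRefl) {V₁ Vinf V₂ Vb L : Submodule K V}
    (hc : IsCompl V₁ Vinf) (h₁ : B.orthogonal V₁ = Vinf) {I : Submodule K V} (hI : B.orthogonal I = I)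
    (h2 : V₂ ≤ V₁) (hb : Vb ≤ V₁) (hsup : V₂ ⊔ Vb = V₁) (horth : Vb ≤ B.orthogonal V₂) (hL : L ≤ Vb)
    (hLself : B.orthogonal L ⊓ Vb = L) :
    B.orthogonal ((I ⊔ L) ⊓ Vinf) ⊓ Vinf = (I ⊔ (V₂ ⊔ L)) ⊓ Vinf := by
  have hU : (⊥ : Submodule K V) ⊔ L ≤ V₁ := by simpa using hL.trans hb
  have key := realSignature_orthogonal hB hR hc h₁ hI hU
  rw [orthogonal_sup_inf_eq_of_selfDual hR h2 hb hsup horth bot_le hL hLself] at key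
  simpa only [bot_sup_eq, LinearMap.BilinForm.orthogonal_bot, top_inf_eq] using key

/-- **Fine/relaxed complementarity in dimensions**: `dim S(L) + dim S(V₂ ⊕ L) = dim V∞` — where the bit
`b(E) = μ((Sel₀^{rel∞}/Sel₀)^∨)` of the cell's `ARCH-BALANCE-v2` lives: the fine side realises few real components
iff the relaxed-at-`2` side realises almost all. [folklore] -/
theorem finrank_realSignature_fine_add_relaxed (hB : B.Nondegenerate) (hR : B.IsRefl)
    {V₁ Vinf V₂ Vb L : Submodule K V} (hc : IsCompl V₁ Vinf) (h₁ : B.orthogonal V₁ = Vinf)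
    {I : Submodule K V} (hI : B.orthogonal I = I) (h2 : V₂ ≤ V₁) (hb : Vb ≤ V₁) (hsup : V₂ ⊔ Vb = V₁)
    (horth : Vb ≤ B.orthogonal V₂) (hL : L ≤ Vb) (hLself : B.orthogonal L ⊓ Vb = L) :
    finrank K ↥((I ⊔ L) ⊓ Vinf) + finrank K ↥((I ⊔ (V₂ ⊔ L)) ⊓ Vinf) = finrank K Vinf := by
  rw [← realSignature_fine_orthogonal hB hR hc h₁ hI h2 hb hsup horth hL hLself, add_comm]
  exact finrank_orthogonal_inf_add hB hR hc h₁ inf_le_right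

/-- **The ordinary structure is Lagrangian at `∞`**: if the condition at `2` is self-dual inside `V₂`
(`W^⊥ ∩ V₂ = W`, as for the ordinary/Greenberg condition under local Tate duality) and `L` is self-dual away from
`2`, then `S(W ⊕ L)^⊥ ∩ V∞ = S(W ⊕ L)` and `2·dim S(W ⊕ L) = dim V∞`: at layer `n` with `E[2] ⊂ E(ℝ)` the Selmer
side realises exactly `2ⁿ` of the `2·2ⁿ` real dimensions — Greenberg's `(Λ/2)^{[Δ_E>0]}` (LNM 1716, L. 4.6).
[folklore] -/
theorem realSignature_ordinary_lagrangian (hB : B.Nondegenerate) (hR : B.IsRefl)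
    {V₁ Vinf V₂ Vb W L : Submodule K V} (hc : IsCompl V₁ Vinf) (h₁ : B.orthogonal V₁ = Vinf)
    {I : Submodule K V} (hI : B.orthogonal I = I) (h2 : V₂ ≤ V₁) (hb : Vb ≤ V₁) (hsup : V₂ ⊔ Vb = V₁)
    (horth : Vb ≤ B.orthogonal V₂) (hW : W ≤ V₂) (hL : L ≤ Vb) (hWself : B.orthogonal W ⊓ V₂ = W)
    (hLself : B.orthogonal L ⊓ Vb = L) :
    B.orthogonal ((I ⊔ (W ⊔ L)) ⊓ Vinf) ⊓ Vinf = (I ⊔ (W ⊔ L)) ⊓ Vinf ∧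
      2 * finrank K ↥((I ⊔ (W ⊔ L)) ⊓ Vinf) = finrank K Vinf := by
  have hU : W ⊔ L ≤ V₁ := sup_le (hW.trans h2) (hL.trans hb)
  have hself : B.orthogonal (W ⊔ L) ⊓ V₁ = W ⊔ L := by
    rw [orthogonal_sup_inf_eq_of_selfDual hR h2 hb hsup horth hW hL hLself, hWself]
  exact ⟨realSignature_orthogonal_self hB hR hc h₁ hI hU hself,
    two_mul_finrank_realSignature hB hR hc h₁ hI hU hself⟩

end Blocks

end Summit.BirchSwinnertonDyer.BirchSwinnertonDyer.Theorems.AlignedTransportAtTwoRealSignature
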